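import Literature.NumberTheory.Sieve.SmoothTernaryCrudeCountScales
import HarnessLib

/-!
# Crude counts of friable solutions of `d₁n₁ ± d₂n₂ = n₃`: two regimes for one shrunken box

Topic `Literature/NumberTheory/Sieve`; a PROVED tool file, the companion of
`SmoothTernaryCrudeCountScales.lean` ([Harper2016, Thm 2 and §5] read in the polylog regime
`y = ⌊(log x)^{100000}⌋`, natural `x → ∞`).  Counting friable solutions of `a + b = c` in boxes with the
divisibility condition `q^v ∣ a` means counting with one SHRUNKEN box `z_j = ⌊B/q^v⌋` (`z_j q^v ≤ x`):

* `TernaryCrudeCount.two_regimes_aux` — the real bookkeeping of the two regimes;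
* `ternary_crude_count_two_regimes` — the Hölder bound `ternary_crude_count_scales` when `z_j ≥ √x`, the
  trivial bound `≤ z_j Ψ(x,y) ≤ √x Ψ(x,y) ≤ x^{-2/5} Ψ(x,y)³/x` otherwise (as `Ψ(x,y) ≥ x^{39999/40000}`), i.e.
  `#{solutions} ≤ C ((log x)^{24} (q^v)^{-7/12} + x^{-2/5}) Ψ(x,y)³/x`, and no solutions at all once `q^v > x`.

## References

* A. J. Harper, *Minor arcs, mean values, and restriction theory for exponential sums over smooth
  numbers*, Compositio Math. 152 (2016) 1121–1158, Theorem 2 and §5 [Harper2016].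
-/

noncomputable section

open Finset Filter Real

namespace Literature.NumberTheory.Sieve

namespace TernaryCrudeCount

/-! ### Two regimes for one shrunken box -/

/-- **Two regimes, real bookkeeping.**  Let `w` be the shrunken box (`w · qv ≤ X`), `cnt ≤ w · Ψ` the trivial
bound and, when `w ≥ √X`, `cnt ≤ C_h L^{24} (w/X)^{7/12} t Ψ³/X` (`0 ≤ t ≤ 1`) the Hölder bound; if
`Ψ ≥ X^{39999/40000}` then `cnt ≤ C (L^{24} qv^{-7/12} + X^{-2/5}) Ψ³/X` for every `C ≥ max(C_h, 1)`, and
`cnt = 0` once `qv > X`. [folklore] -/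
theorem two_regimes_aux {X L Ψ Ch C t : ℝ} {w cnt qv : ℕ} (hX : 1 ≤ X) (hChC : Ch ≤ C)
    (hC1 : 1 ≤ C) (hΨ : X ^ ((39999 : ℝ) / 40000) ≤ Ψ) (hqv : 1 ≤ qv) (hw : (w : ℝ) * qv ≤ X)
    (htriv : (cnt : ℝ) ≤ w * Ψ)
    (hhold : X ^ (1 / 2 : ℝ) ≤ w → (cnt : ℝ) ≤ Ch * L ^ 24 * ((w : ℝ) / X) ^ (7 / 12 : ℝ) * t * Ψ ^ 3 / X)
    (ht0 : 0 ≤ t) (ht1 : t ≤ 1) :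
    (cnt : ℝ) ≤ C * (L ^ 24 * ((qv : ℝ)⁻¹) ^ (7 / 12 : ℝ) + X⁻¹ ^ (2 / 5 : ℝ)) * Ψ ^ 3 / X ∧
      (X < qv → cnt = 0) := by
  have hX0 : 0 < X := by linarith
  have hΨ0 : 0 < Ψ := lt_of_lt_of_le (Real.rpow_pos_of_pos hX0 _) hΨ
  have hqv0 : (0 : ℝ) < qv := by exact_mod_cast hqv
  have hL24 : 0 ≤ L ^ 24 := by positivity
  have hq0 : 0 ≤ ((qv : ℝ)⁻¹) ^ (7 / 12 : ℝ) := Real.rpow_nonneg (by positivity) _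
  have hA0 : 0 ≤ L ^ 24 * ((qv : ℝ)⁻¹) ^ (7 / 12 : ℝ) := mul_nonneg hL24 hq0
  have hB0 : 0 ≤ X⁻¹ ^ (2 / 5 : ℝ) := Real.rpow_nonneg (by positivity) _
  have hΨ3X : 0 ≤ Ψ ^ 3 / X := by positivity
  refine ⟨?_, fun hlt => ?_⟩
  · by_cases hreg : X ^ (1 / 2 : ℝ) ≤ w
    · -- the Hölder regime: `(w/X)^{7/12} ≤ qv^{-7/12}`, `t ≤ 1`
      have h := hhold hreg
      have hwX : (w : ℝ) / X ≤ (qv : ℝ)⁻¹ := by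
        rw [div_le_iff₀ hX0]
        have : (w : ℝ) * qv * (qv : ℝ)⁻¹ ≤ X * (qv : ℝ)⁻¹ :=
          mul_le_mul_of_nonneg_right hw (inv_nonneg.2 hqv0.le)
        rwa [mul_assoc, mul_inv_cancel₀ hqv0.ne', mul_one, mul_comm] at this
      have hr : ((w : ℝ) / X) ^ (7 / 12 : ℝ) ≤ ((qv : ℝ)⁻¹) ^ (7 / 12 : ℝ) :=
        Real.rpow_le_rpow (by positivity) hwX (by norm_num)
      calc (cnt : ℝ) ≤ Ch * L ^ 24 * ((w : ℝ) / X) ^ (7 / 12 : ℝ) * t * Ψ ^ 3 / X := h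
        _ = Ch * (L ^ 24 * ((w : ℝ) / X) ^ (7 / 12 : ℝ)) * t * (Ψ ^ 3 / X) := by ring
        _ ≤ C * (L ^ 24 * ((qv : ℝ)⁻¹) ^ (7 / 12 : ℝ)) * 1 * (Ψ ^ 3 / X) := by
            refine mul_le_mul_of_nonneg_right ?_ hΨ3X
            refine mul_le_mul ?_ ht1 ht0 (mul_nonneg (by linarith) hA0)
            exact mul_le_mul hChC (mul_le_mul_of_nonneg_left hr hL24)
              (mul_nonneg hL24 (Real.rpow_nonneg (by positivity) _)) (by linarith)
        _ ≤ C * (L ^ 24 * ((qv : ℝ)⁻¹) ^ (7 / 12 : ℝ) + X⁻¹ ^ (2 / 5 : ℝ)) * (Ψ ^ 3 / X) := by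
            rw [mul_one]
            refine mul_le_mul_of_nonneg_right (mul_le_mul_of_nonneg_left (by linarith) (by linarith)) hΨ3X
        _ = _ := by ring
    · -- the trivial regime: `cnt ≤ w Ψ ≤ √X Ψ ≤ X^{-2/5} Ψ³ / X`
      push Not at hreg
      have h1 : (cnt : ℝ) ≤ X ^ (1 / 2 : ℝ) * Ψ :=
        htriv.trans (mul_le_mul_of_nonneg_right hreg.le hΨ0.le)
      have hΨ2 : X ^ ((19 : ℝ) / 10) ≤ Ψ ^ 2 := by
        calc X ^ ((19 : ℝ) / 10) ≤ X ^ ((39999 : ℝ) / 20000) :=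
              Real.rpow_le_rpow_of_exponent_le hX (by norm_num)
          _ = (X ^ ((39999 : ℝ) / 40000)) ^ 2 := by
              rw [← Real.rpow_natCast, ← Real.rpow_mul hX0.le]; norm_num
          _ ≤ Ψ ^ 2 := pow_le_pow_left₀ (Real.rpow_nonneg hX0.le _) hΨ 2
      have h2 : X ^ (1 / 2 : ℝ) * Ψ ≤ X⁻¹ ^ (2 / 5 : ℝ) * Ψ ^ 3 / X := by
        rw [le_div_iff₀ hX0, Real.inv_rpow hX0.le, ← Real.rpow_neg hX0.le]
        have e : X ^ (1 / 2 : ℝ) * Ψ * X = Ψ * (X ^ ((19 : ℝ) / 10) * X ^ (-(2 / 5 : ℝ))) := by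
          rw [← Real.rpow_add hX0, show (19 : ℝ) / 10 + -(2 / 5 : ℝ) = 1 / 2 + 1 by norm_num,
            Real.rpow_add hX0, Real.rpow_one]
          ring
        rw [e]
        calc Ψ * (X ^ ((19 : ℝ) / 10) * X ^ (-(2 / 5 : ℝ))) ≤ Ψ * (Ψ ^ 2 * X ^ (-(2 / 5 : ℝ))) :=
              mul_le_mul_of_nonneg_left (mul_le_mul_of_nonneg_right hΨ2 (Real.rpow_nonneg hX0.le _)) hΨ0.le
          _ = X ^ (-(2 / 5 : ℝ)) * Ψ ^ 3 := by ring
      calc (cnt : ℝ) ≤ X⁻¹ ^ (2 / 5 : ℝ) * Ψ ^ 3 / X := h1.trans h2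
        _ = 1 * (0 + X⁻¹ ^ (2 / 5 : ℝ)) * (Ψ ^ 3 / X) := by ring
        _ ≤ C * (L ^ 24 * ((qv : ℝ)⁻¹) ^ (7 / 12 : ℝ) + X⁻¹ ^ (2 / 5 : ℝ)) * (Ψ ^ 3 / X) := by
            refine mul_le_mul_of_nonneg_right ?_ hΨ3X
            exact mul_le_mul hC1 (by linarith) (by linarith) (by linarith)
        _ = _ := by ring
  · -- `w qv ≤ X < qv` forces `w = 0`
    have hw1 : (w : ℝ) < 1 := by
      by_contra h
      push Not at h
      have : (qv : ℝ) ≤ w * qv := le_mul_of_one_le_left hqv0.le h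
      linarith
    have hw0 : w = 0 := Nat.lt_one_iff.1 (by exact_mod_cast hw1)
    rw [hw0, Nat.cast_zero, zero_mul] at htriv
    exact_mod_cast le_antisymm htriv (Nat.cast_nonneg cnt)

end TernaryCrudeCount

open TernaryCrudeCount

/-- **Two regimes for one shrunken box.**  For all large natural `x`, with `y = ⌊(log x)^{100000}⌋`,
`Ψ = Ψ(x, y)`: for an odd prime `q`, `v`, natural boxes `z₁, z₂, z₃ ≤ x` with `z₃ ≥ √x`, dilations `d₁d₂ ∣ (2q)^k`,
`σ = ±1`, `d₁z₁ + d₂z₂ + z₃ ≤ x`, and ONE of `z₁, z₂` shrunken by `q^v` (`z_j q^v ≤ x`) while the other is `≥ √x`: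
the number of `(n₁, n₂, n₃) ∈ S(z₁,y) × S(z₂,y) × S(z₃,y)` with `d₁n₁ + σd₂n₂ = n₃` is at most
`C ((log x)^{24} (q^v)^{-7/12} + x^{-2/5}) Ψ³/x` (Hölder when `z_j ≥ √x`, trivial otherwise), and is `0` when
`q^v > x`. [cite: Harper2016, Theorem 2 and §5] -/
theorem ternary_crude_count_two_regimes :
    ∃ C : ℝ, 0 < C ∧ ∀ᶠ x : ℕ in atTop, ∀ (q v : ℕ), q.Prime → q ≠ 2 →
      ∀ (z₁ z₂ z₃ d₁ d₂ k : ℕ) (σ : ℤ), (σ = 1 ∨ σ = -1) → d₁ * d₂ ∣ (2 * q) ^ k →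
      (x : ℝ) ^ (1 / 2 : ℝ) ≤ z₃ → z₁ ≤ x → z₂ ≤ x → z₃ ≤ x →
      (z₁ * q ^ v ≤ x ∧ (x : ℝ) ^ (1 / 2 : ℝ) ≤ z₂ ∨ z₂ * q ^ v ≤ x ∧ (x : ℝ) ^ (1 / 2 : ℝ) ≤ z₁) →
      d₁ * z₁ + d₂ * z₂ + z₃ ≤ x →
      (#((Nat.smoothNumbersUpTo z₁ (⌊Real.log x ^ 100000⌋₊ + 1) ×ˢ
            Nat.smoothNumbersUpTo z₂ (⌊Real.log x ^ 100000⌋₊ + 1) ×ˢ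
            Nat.smoothNumbersUpTo z₃ (⌊Real.log x ^ 100000⌋₊ + 1)).filter
          (fun t : ℕ × ℕ × ℕ => (d₁ * t.1 : ℤ) + σ * (d₂ * t.2.1) = t.2.2)) : ℝ) ≤
        C * (Real.log x ^ 24 * (((q : ℝ) ^ v)⁻¹) ^ (7 / 12 : ℝ) + ((x : ℝ)⁻¹) ^ (2 / 5 : ℝ)) *
          ((Nat.smoothNumbersUpTo x (⌊Real.log x ^ 100000⌋₊ + 1)).card : ℝ) ^ 3 / x ∧
      (x < q ^ v →
        #((Nat.smoothNumbersUpTo z₁ (⌊Real.log x ^ 100000⌋₊ + 1) ×ˢ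
            Nat.smoothNumbersUpTo z₂ (⌊Real.log x ^ 100000⌋₊ + 1) ×ˢ
            Nat.smoothNumbersUpTo z₃ (⌊Real.log x ^ 100000⌋₊ + 1)).filter
          (fun t : ℕ × ℕ × ℕ => (d₁ * t.1 : ℤ) + σ * (d₂ * t.2.1) = t.2.2)) = 0) := by
  obtain ⟨Ch, hCh, hH⟩ := ternary_crude_count_scales
  refine ⟨max Ch 1, lt_max_of_lt_left hCh, ?_⟩
  have T : Tendsto (fun x : ℕ => (x : ℝ)) atTop atTop := tendsto_natCast_atTop_atTop
  filter_upwards [hH, T.eventually (polylog_regime_at_scales 0), T.eventually polylog_regime_basic]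
    with x hHx hsc hb q v hq hq2 z₁ z₂ z₃ d₁ d₂ k σ hσ hdk hz₃ hz₁x hz₂x hz₃x hshr hwrap
  obtain ⟨hx1, -, -, -, -, -, -, -, -, -, hsqrtx⟩ := hb
  obtain ⟨-, -, -, -, -, gₓ⟩ := hsc x hsqrtx le_rfl
  rw [Nat.floor_natCast] at gₓ
  set y : ℕ := ⌊Real.log (x : ℝ) ^ 100000⌋₊ with hy
  set Ψx : ℝ := ((Nat.smoothNumbersUpTo x (y + 1)).card : ℝ) with hΨx
  set S₁ := Nat.smoothNumbersUpTo z₁ (y + 1) with hS₁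
  set S₂ := Nat.smoothNumbersUpTo z₂ (y + 1) with hS₂
  set S₃ := Nat.smoothNumbersUpTo z₃ (y + 1) with hS₃
  set cnt : ℕ := #((S₁ ×ˢ S₂ ×ˢ S₃).filter
      (fun t : ℕ × ℕ × ℕ => (d₁ * t.1 : ℤ) + σ * (d₂ * t.2.1) = t.2.2)) with hcnt
  have hq1 : 1 ≤ q ^ v := Nat.one_le_pow _ _ hq.pos
  have hqv : ((q ^ v : ℕ) : ℝ) = (q : ℝ) ^ v := by push_cast; ring
  -- the trivial bound and the cardinalities of the boxes
  have htriv : cnt ≤ #S₁ * #S₂ := card_ternaryFilter_le_card_mul S₁ S₂ S₃ d₁ d₂ σ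
  have hS₁z : #S₁ ≤ z₁ := card_smoothNumbersUpTo_le_self z₁ _
  have hS₂z : #S₂ ≤ z₂ := card_smoothNumbersUpTo_le_self z₂ _
  have hS₁Ψ : (#S₁ : ℝ) ≤ Ψx := by
    rw [hΨx]; exact_mod_cast Finset.card_le_card (Endgame.smoothNumbersUpTo_mono_left hz₁x (y + 1))
  have hS₂Ψ : (#S₂ : ℝ) ≤ Ψx := by
    rw [hΨx]; exact_mod_cast Finset.card_le_card (Endgame.smoothNumbersUpTo_mono_left hz₂x (y + 1))
  have hΨx0 : 0 ≤ Ψx := Nat.cast_nonneg _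
  have ht : ∀ {u : ℕ}, u ≤ x → 0 ≤ ((u : ℝ) / x) ^ (7 / 12 : ℝ) ∧ ((u : ℝ) / x) ^ (7 / 12 : ℝ) ≤ 1 :=
    fun hu => ⟨Real.rpow_nonneg (by positivity) _,
      Real.rpow_le_one (by positivity) ((div_le_one (by linarith)).2 (by exact_mod_cast hu)) (by norm_num)⟩
  rcases hshr with ⟨hw, hu⟩ | ⟨hw, hu⟩
  · -- shrunken first box
    obtain ⟨ht0, ht1⟩ := ht hz₂x
    have hw' : (z₁ : ℝ) * ((q ^ v : ℕ) : ℝ) ≤ x := by exact_mod_cast hw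
    have htriv' : (cnt : ℝ) ≤ z₁ * Ψx := by
      calc (cnt : ℝ) ≤ (#S₁ : ℝ) * #S₂ := by exact_mod_cast htriv
        _ ≤ z₁ * Ψx := mul_le_mul (by exact_mod_cast hS₁z) hS₂Ψ (Nat.cast_nonneg _) (Nat.cast_nonneg _)
    have hres := two_regimes_aux (Ch := Ch) (C := max Ch 1) (L := Real.log x)
      (t := ((z₂ : ℝ) / x) ^ (7 / 12 : ℝ)) hx1.le
      (le_max_left _ _) (le_max_right _ _) gₓ hq1 hw' htriv' (fun hreg => ?_) ht0 ht1
    · rw [hqv] at hres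
      exact ⟨hres.1, fun hlt => hres.2 (by exact_mod_cast hlt)⟩
    · have h := hHx q hq hq2 z₁ z₂ z₃ d₁ d₂ k σ hσ hdk hreg hu hz₃ hz₁x hz₂x hz₃x hwrap
      calc (cnt : ℝ) ≤ _ := h
        _ = _ := by ring
  · -- shrunken second box
    obtain ⟨ht0, ht1⟩ := ht hz₁x
    have hw' : (z₂ : ℝ) * ((q ^ v : ℕ) : ℝ) ≤ x := by exact_mod_cast hw
    have htriv' : (cnt : ℝ) ≤ z₂ * Ψx := by
      calc (cnt : ℝ) ≤ (#S₁ : ℝ) * #S₂ := by exact_mod_cast htriv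
        _ ≤ Ψx * z₂ := mul_le_mul hS₁Ψ (by exact_mod_cast hS₂z) (Nat.cast_nonneg _) hΨx0
        _ = z₂ * Ψx := mul_comm _ _
    have hres := two_regimes_aux (Ch := Ch) (C := max Ch 1) (L := Real.log x)
      (t := ((z₁ : ℝ) / x) ^ (7 / 12 : ℝ)) hx1.le
      (le_max_left _ _) (le_max_right _ _) gₓ hq1 hw' htriv' (fun hreg => ?_) ht0 ht1
    · rw [hqv] at hres
      exact ⟨hres.1, fun hlt => hres.2 (by exact_mod_cast hlt)⟩
    · have h := hHx q hq hq2 z₁ z₂ z₃ d₁ d₂ k σ hσ hdk hu hreg hz₃ hz₁x hz₂x hz₃x hwrap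
      calc (cnt : ℝ) ≤ _ := h
        _ = _ := by ring

end Literature.NumberTheory.Sieve

end
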